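import Mathlib.NumberTheory.NumberField.Completion.FinitePlace
import Mathlib.NumberTheory.NumberField.AdeleRing
import Mathlib.Topology.Algebra.Valued.LocallyCompact
import HarnessLib

/-!
# Compactness of the local integers `𝒪_v` of a number field

Trunk `AutomorphicAxiomatic` (G19), topic `NumberTheory/Automorphic`; namespace `Literature.Automorphic`.

For a number field `K` and a finite place `v` (a non-zero prime `v` of `𝓞 K`), the valuation ring
`𝒪_v = v.adicCompletionIntegers K` of the completion `K_v = v.adicCompletion K` is compact, and
`K_v` is a proper (hence locally compact) metric space: `K_v` is a "p-field" in the sense of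
Weil, *Basic Number Theory*, Ch. I §4, and the completions of an A-field at its finite places are
p-fields (Weil, Ch. III §1). This is the input needed to make the finite adele ring and the adele
ring of `K` locally compact (Mathlib's restricted-product instances then apply).

Mathlib (at the pinned revision) has the criterion
`Valued.integer.compactSpace_iff_completeSpace_and_isDiscreteValuationRing_and_finite_residueField`
(compact iff complete, discretely valued and with finite residue field), that `𝒪_v` is a complete
DVR, and that `𝓞 K ⧸ v` is finite, but not the finiteness of the residue field of `𝒪_v`; the
missing step, proved here, is that the residue map `𝓞 K → 𝒪_v ⧸ 𝓂_v` is onto (density of `K` in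
`K_v` and of `𝓞 K` in `K ∩ 𝒪_v`, Mathlib `HeightOneSpectrum.exists_valuation_sub_lt_of_integer`)
and kills `v`.

## Main results

* `exists_ringOfIntegers_valued_sub_lt_one` : every `x ∈ 𝒪_v` is congruent mod `𝓂_v` to a global
  integer;
* `finite_residueField_adicCompletion` : the residue field of `𝒪_v` is finite;
* `compactSpace_adicCompletionIntegers'` : `𝒪_v` is compact;
* `properSpace_adicCompletion`, `locallyCompactSpace_adicCompletion` : `K_v` is proper and locally
  compact.

## References

* A. Weil, *Basic Number Theory* (1967), Ch. I §4 (p-fields: the maximal compact subring), Ch. III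
  §1 (completions of A-fields are local fields).
* J. W. S. Cassels, A. Fröhlich (eds.), *Algebraic Number Theory* (1967), Ch. II §7–§8.
-/

noncomputable section

namespace Literature.NumberTheory.Automorphic

open NumberField IsDedekindDomain Valued
open scoped RestrictedProduct

section CompactIntegers

variable (K : Type*) [Field K] [NumberField K] (v : HeightOneSpectrum (𝓞 K))

/-- **Density of `𝓞 K` in `𝒪_v` modulo `𝓂_v`.** Every local integer `x ∈ 𝒪_v ⊆ K_v` is within
valuation `< 1` of (the image of) a global integer `a ∈ 𝓞 K`: `K` is dense in `K_v`
(Mathlib `HeightOneSpectrum.denseRange_algebraMap`), an element of `K` close to `x` is a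
`v`-integer of `K`, and those are approximated by `𝓞 K` (Mathlib
`HeightOneSpectrum.exists_valuation_sub_lt_of_integer`); Weil, BNT Ch. III §1 (`r_v` is the
closure of `r` in `k_v`). [folklore] -/
theorem exists_ringOfIntegers_valued_sub_lt_one (x : 𝒪[v.adicCompletion K]) :
    ∃ a : 𝓞 K,
      Valued.v (algebraMap K (v.adicCompletion K) (algebraMap (𝓞 K) K a) -
        (x : v.adicCompletion K)) < 1 := by
  -- valuations of global elements
  have hval : ∀ c : K, Valued.v (algebraMap K (v.adicCompletion K) c) = v.valuation K c :=
    fun c => HeightOneSpectrum.valuedAdicCompletion_eq_valuation' v c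
  -- the open unit ball around `x` meets `K`
  have hopen : IsOpen {y : v.adicCompletion K | Valued.v (y - x) < 1} := by
    have h1 : IsOpen {z : v.adicCompletion K | Valued.v z < 1} := by
      simpa only [Valuation.restrict_lt_one_iff] using Valued.isOpen_ball (v.adicCompletion K) 1
    exact h1.preimage (continuous_id.sub continuous_const)
  obtain ⟨k, hk⟩ := (HeightOneSpectrum.denseRange_algebraMap (K := K) v).exists_mem_open hopen
    ⟨x, by simp⟩
  rw [Set.mem_setOf_eq] at hk
  -- `k` is a `v`-integer of `K`
  have hk1 : v.valuation K k ≤ 1 := by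
    rw [← hval]
    have hx : Valued.v (x : v.adicCompletion K) ≤ 1 := x.2
    have := Valuation.map_add Valued.v (algebraMap K (v.adicCompletion K) k - x)
      (x : v.adicCompletion K)
    rw [sub_add_cancel] at this
    exact this.trans (max_le hk.le hx)
  -- approximate `k` by a global integer
  obtain ⟨a, ha⟩ := v.exists_valuation_sub_lt_of_integer hk1 1
  refine ⟨a, ?_⟩
  have h2 : Valued.v (algebraMap K (v.adicCompletion K) (algebraMap (𝓞 K) K a) -
      algebraMap K (v.adicCompletion K) k) < 1 := by
    rw [← map_sub, hval]
    exact_mod_cast ha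
  have := Valuation.map_add_lt Valued.v h2 hk
  rwa [sub_add_sub_cancel] at this

/-- **The residue field of `𝒪_v` is finite** (`= 𝓞 K ⧸ v`): the residue map `𝓞 K → 𝒪_v ⧸ 𝓂_v` is
onto (`exists_ringOfIntegers_valued_sub_lt_one`) and vanishes on `v`, and `𝓞 K ⧸ v` is finite
(Mathlib `Ideal.finiteQuotientOfFreeOfNeBot`). Weil, BNT Ch. III §1 with Ch. I §4 (the residue
field of a p-field is finite). [folklore] -/
theorem finite_residueField_adicCompletion : Finite 𝓀[v.adicCompletion K] := by
  classical
  -- the map `𝓞 K → 𝒪_v → 𝓀_v`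
  have hval : ∀ c : K, Valued.v (algebraMap K (v.adicCompletion K) c) = v.valuation K c :=
    fun c => HeightOneSpectrum.valuedAdicCompletion_eq_valuation' v c
  let ι : 𝓞 K → 𝒪[v.adicCompletion K] := fun a =>
    ⟨algebraMap K (v.adicCompletion K) (algebraMap (𝓞 K) K a), by
      change Valued.v (algebraMap K (v.adicCompletion K) (algebraMap (𝓞 K) K a)) ≤ 1
      rw [hval]
      exact HeightOneSpectrum.valuation_le_one v a⟩
  let f : 𝓞 K → 𝓀[v.adicCompletion K] := fun a =>
    IsLocalRing.residue (𝒪[v.adicCompletion K]) (ι a)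
  -- membership in `𝓂_v` is `valuation < 1`
  have hmax : ∀ z : 𝒪[v.adicCompletion K],
      z ∈ IsLocalRing.maximalIdeal (𝒪[v.adicCompletion K]) ↔
        Valued.v (z : v.adicCompletion K) < 1 := fun z => by
    rw [IsLocalRing.mem_maximalIdeal, mem_nonunits_iff]
    exact Valuation.Integer.not_isUnit_iff_valuation_lt_one
  -- `f` is onto
  have hf : Function.Surjective f := by
    intro q
    obtain ⟨x, rfl⟩ := IsLocalRing.residue_surjective q
    obtain ⟨a, ha⟩ := exists_ringOfIntegers_valued_sub_lt_one K v x
    refine ⟨a, ?_⟩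
    change Ideal.Quotient.mk _ (ι a) = Ideal.Quotient.mk _ x
    rw [Ideal.Quotient.eq, hmax]
    exact ha
  -- `f` factors through the finite ring `𝓞 K ⧸ v`
  haveI : Finite (𝓞 K ⧸ v.asIdeal) := v.asIdeal.finiteQuotientOfFreeOfNeBot v.ne_bot
  have hfact : ∀ a b : 𝓞 K, Ideal.Quotient.mk v.asIdeal a = Ideal.Quotient.mk v.asIdeal b →
      f a = f b := by
    intro a b hab
    rw [Ideal.Quotient.eq] at hab
    change Ideal.Quotient.mk _ (ι a) = Ideal.Quotient.mk _ (ι b)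
    rw [Ideal.Quotient.eq, hmax]
    have hlt : v.valuation K (algebraMap (𝓞 K) K (a - b)) < 1 :=
      (HeightOneSpectrum.valuation_lt_one_iff_mem v (a - b)).2 hab
    have : ((ι a - ι b : 𝒪[v.adicCompletion K]) : v.adicCompletion K) =
        algebraMap K (v.adicCompletion K) (algebraMap (𝓞 K) K (a - b)) := by
      change algebraMap K (v.adicCompletion K) (algebraMap (𝓞 K) K a) -
          algebraMap K (v.adicCompletion K) (algebraMap (𝓞 K) K b) = _
      rw [← map_sub, ← map_sub]
    rw [this, hval]
    exact hlt
  let g : 𝓞 K ⧸ v.asIdeal → 𝓀[v.adicCompletion K] :=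
    Quotient.lift f fun a b (hab : (QuotientAddGroup.leftRel _) a b) =>
      hfact a b (Quotient.sound hab)
  refine Finite.of_surjective g fun q => ?_
  obtain ⟨a, rfl⟩ := hf q
  exact ⟨Ideal.Quotient.mk v.asIdeal a, rfl⟩

/-- **`𝒪_v` is compact** (as the valuation ring `𝒪[K_v]` of the valued field `K_v`): it is
complete (closed in the complete field `K_v`), a DVR (Mathlib), and has finite residue field
(`finite_residueField_adicCompletion`); Mathlib's criterion
`Valued.integer.compactSpace_iff_completeSpace_and_isDiscreteValuationRing_and_finite_residueField`
then applies. Weil, BNT Ch. I §4 and Ch. III §1 (`r_v` is the maximal compact subring of the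
p-field `k_v`). [cite: WeilBNT1967, Ch. III §1 (completions of an A-field at finite places are p-fields) with Ch. I §4 Thm. 6] -/
theorem compactSpace_integer_adicCompletion : CompactSpace 𝒪[v.adicCompletion K] := by
  haveI : IsDiscreteValuationRing 𝒪[v.adicCompletion K] :=
    inferInstanceAs (IsDiscreteValuationRing (v.adicCompletionIntegers K))
  haveI : CompleteSpace 𝒪[v.adicCompletion K] :=
    completeSpace_coe_iff_isComplete.2 (Valued.isClosed_integer (v.adicCompletion K)).isComplete
  exact Valued.integer.compactSpace_iff_completeSpace_and_isDiscreteValuationRing_and_finite_residueField.2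
    ⟨‹_›, ‹_›, finite_residueField_adicCompletion K v⟩

/-- **`𝒪_v = v.adicCompletionIntegers K` is compact** for every finite place `v` of a number
field (the same statement as `compactSpace_integer_adicCompletion`, for Mathlib's name of the
valuation ring). Weil, BNT Ch. III §1 / Ch. I §4. [cite: WeilBNT1967, Ch. III §1 (completions of an A-field at finite places are p-fields) with Ch. I §4 Thm. 6] -/
theorem compactSpace_adicCompletionIntegers' : CompactSpace (v.adicCompletionIntegers K) :=
  compactSpace_integer_adicCompletion K v

/-- `K_v` is a proper metric space (closed balls are compact), by Mathlib's
`Valued.integer.properSpace_iff_compactSpace_integer`; Weil, BNT Ch. I §4. [folklore] -/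
theorem properSpace_adicCompletion : ProperSpace (v.adicCompletion K) :=
  Valued.integer.properSpace_iff_compactSpace_integer.2 (compactSpace_integer_adicCompletion K v)

/-- `K_v` is locally compact (a "p-field", Weil, BNT Ch. I §4, Ch. III §1). [folklore] -/
theorem locallyCompactSpace_adicCompletion : LocallyCompactSpace (v.adicCompletion K) := by
  haveI := properSpace_adicCompletion K v
  infer_instance

/-- `𝒪_v` is open in `K_v` (Mathlib `Valued.isOpen_valuationSubring`), recorded as the `Fact`
consumed by Mathlib's restricted-product instances. [folklore] -/
theorem fact_isOpen_adicCompletionIntegers :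
    Fact (∀ v : HeightOneSpectrum (𝓞 K),
      IsOpen (v.adicCompletionIntegers K : Set (v.adicCompletion K))) :=
  ⟨fun _ => Valued.isOpen_valuationSubring _⟩

/-- **The finite adele ring `𝔸_K^∞` of a number field is locally compact** (restricted product of
the locally compact `K_v` with respect to the compact open `𝒪_v`; Mathlib's `RestrictedProduct`
instance). Weil, BNT Ch. IV §1. [folklore] -/
theorem locallyCompactSpace_finiteAdeleRing' :
    LocallyCompactSpace (FiniteAdeleRing (𝓞 K) K) := by
  haveI : ∀ v : HeightOneSpectrum (𝓞 K), CompactSpace (v.adicCompletionIntegers K) :=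
    compactSpace_adicCompletionIntegers' K
  haveI := fact_isOpen_adicCompletionIntegers K
  exact inferInstanceAs (LocallyCompactSpace (Πʳ v : HeightOneSpectrum (𝓞 K),
    [v.adicCompletion K, v.adicCompletionIntegers K]))

/-- **The adele ring `𝔸_K = K_∞ × 𝔸_K^∞` of a number field is locally compact** (`K_∞` is locally
compact in Mathlib: `InfiniteAdeleRing.locallyCompactSpace`). Weil, BNT Ch. IV §1. [folklore] -/
theorem locallyCompactSpace_adeleRing' : LocallyCompactSpace (AdeleRing (𝓞 K) K) := by
  haveI := locallyCompactSpace_finiteAdeleRing' K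
  exact inferInstanceAs (LocallyCompactSpace (InfiniteAdeleRing K × FiniteAdeleRing (𝓞 K) K))

end CompactIntegers

end Literature.NumberTheory.Automorphic
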